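import Literature.MathematicalPhysics.QuantumFieldTheory.Balaban1983to89.B9Thm311SitePrimeFormCoerciveBlockGauge
import Literature.MathematicalPhysics.QuantumFieldTheory.Balaban1983to89.B9Eq316TowerFlatIsOneStep

/-!
# `Balaban1983to89.B9Eq323TowerBlockPoincare` — T. Bałaban, *Regularity and decay of lattice Green's functions*, Commun. Math. Phys. **89** (1983) 571–597
# [Balaban1983RegularityDecay] (2.27) p. 580 with [Balaban1984PropagatorsI] (1.18) p. 20 («L replaced by L^k») and [Balaban1985Averaging] (2) p. 17:
# **BLOCK POINCARÉ WITH MEANS ON THE UNIT BLOCK OF THE TOWER `T_{L^{n+1}m}`** — `Σ_{x over y}‖g x‖² ≤ (N−1)N·Σ_{b over y, b₊ over y}‖g(b₊) − g(b₋)‖² +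
# 2N^d‖N^{−d}Σ_{x over y} g x‖²`, `N = L^{n+1}`, «`x` over `y`» = `x_i div L^{n+1} = y_i` — this lineage's one-step (P1) §1
# `B9Thm311SitePrimeFormCoerciveBlockGauge.sum_block_norm_sq_le_poincare_mean` AT BLOCK SIZE `L^{n+1}`, transported along the owner's
# `towerP_eq_fineP_pow` ∕ `siteCast`; plus the unit-block bookkeeping of `T_{L^{n+1}m}` (Jensen, fibre sums, internal bonds ≤ all bonds)

statement-level skeleton of published theorems with citation tags; proofs where landed; nothing here is a claim about the Yang–Mills mass gap

CITATION HEADER (lean-in-tree rule).  Audit cell `pub-balaban`, sub-cell `t4`, BINDER row NE9; filed by NE9 formalisation-swarm leaf prover 03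
(`b2b-balaban-t4-ne9-formalise-leaf-03`, gen 64), brick (T4a) of the k-level Tier P programme (journal l.47756): the transport half of the twin of
`B9Thm311SitePrimeFormCoerciveBlockGauge`.  Sources READ: [B4] p. 580, [B5] p. 20, [B7] p. 17 through the verbatim headers of `B9Eq323FlatBlockPoincare` ∕
`B9Eq316TowerFlatIsOneStep` (lineage custody).  Objects BY NAME: `towerP`, `siteCast`, `siteCast_apply_val`, `siteCast_symm`, `blockOf`, `blockCoord`,
`sum_block_norm_sq_le_poincare_mean`, `blockMean_norm_sq_le`, `shiftEquiv`; nothing re-declared, 0 `def`.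

THE PRINT (verbatim).  [B4] (2.27) p. 580: the block Poincaré inequality (quoted in `B9Eq323FlatBlockPoincare`).  [B5] (1.18) p. 20: *«a composition of k
transformations … is again a transformation of the same type with L replaced by L^k»*.  [B7] (2) p. 17: *«we define a block … as the cube B^j(y)»*.

WHAT IS PROVED (sorry-free; proof lane — 0 `def`; [folklore] transport).
* `siteCast_shift`, `sum_over_eq_sum_blockOf_cast`, `sum_bond_over_eq_cast` (the sites ∕ internal bonds over `y` are the block ∕ internal bonds of `y` at
  block size `L^{n+1}` through the cast); **`sum_over_norm_sq_le_poincare_mean`** (the display above); `overMean_norm_sq_le` (Jensen on the unit block);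
  `sum_over_sum` (`Σ_y Σ_{x over y} = Σ_x`), `sum_bond_internal_le` (internal bonds over the blocks ≤ all bonds, nonnegative summand), `sum_bond_tgt_eq_tower`
  (each site is `b₊` of `d` bonds).
HONEST SCOPE.  [folklore] bookkeeping; consumer: `B9Thm311SitePrimeFormCoerciveTowerBlockGauge` (T4b).  NOT summit progress (cell pub-balaban: NE9 NOT
PRINTED ∕ NOT PROVED; «NE9 ⇐ the named binders»; spine PROVED 0/9; rung (B)+1 finite T⁴ — NOT infinite volume, NOT mass gap, NOT Clay; HONEST DEPENDENCY:
continuum YM on T⁴ ⇐ BetaPertH ∧ nine spine estimates (0/9 proved); BetaPertH ⇐ (D1) ∧ (D4) ∧ CAP+tail; G-an2-4 gates asym, D1 and NE2/3/4).  NEW file;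
nothing modified.  Net new unproved facts: 0.
-/

noncomputable section

open scoped BigOperators InnerProductSpace ComplexConjugate

namespace Literature.MathematicalPhysics.QuantumFieldTheory.Balaban1983to89.B9Eq323TowerBlockPoincare

open B4Sect5Torus (TSite)
open B9SectCLatticeCarrier (Bond shift)
open B9Eq319QprimeTorus (fineP blockCoord mem_blockOf_iff)
open B9Eq315QTower (towerP)
open B9Eq316TowerFlatIsOneStep (towerP_eq_fineP_pow siteCast siteCast_apply_val siteCast_symm)
open B9Thm311SitePrimeFormCoerciveBlockGauge (sum_block_norm_sq_le_poincare_mean)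
open B9Eq33CovDerivVector (shiftEquiv)

variable {d : ℕ} (L : ℕ) [NeZero L] (m : Fin d → ℕ) (n : ℕ)
/-! ## §1 Transport: the unit block of `T_{L^{n+1}m}` is the one-step block at block size `L^{n+1}` -/

section Transport

variable {P P' : Fin d → ℕ}

omit [NeZero L] in
/-- the site cast commutes with the unit steps. [cite: Balaban1985Averaging, (1)–(2) p.17] -/
theorem siteCast_shift (h : P = P') (μ : Fin d) (x : TSite d P) : siteCast h (shift μ x) = shift μ (siteCast h x) := by
  subst h; rfl

variable {M : Type*} [AddCommMonoid M]

omit [NeZero L] in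
/-- **the sites over `y` are the block of `y` at block size `L^{n+1}`** (through the cast). [cite: Balaban1984PropagatorsI, (1.18) p.20; Balaban1985Averaging, (2) p.17] -/
theorem sum_over_eq_sum_blockOf_cast (h : towerP L m (n + 1) = fineP (L ^ (n + 1)) m) (y : TSite d m) (F : TSite d (towerP L m (n + 1)) → M) :
    ∑ x ∈ Finset.univ.filter (fun x : TSite d (towerP L m (n + 1)) => ∀ i, (x i : ℕ) / L ^ (n + 1) = (y i : ℕ)), F x =
      ∑ x' ∈ B9Eq319QprimeTorus.blockOf (L ^ (n + 1)) m y, F ((siteCast h).symm x') := by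
  refine Finset.sum_equiv (siteCast h) (fun x => ?_) (fun x _ => by rw [Equiv.symm_apply_apply])
  rw [Finset.mem_filter, mem_blockOf_iff]
  simp only [Finset.mem_univ, true_and]
  constructor
  · intro hx; funext i; apply Fin.ext; rw [B9Eq319QprimeTorus.blockCoord_apply_val, siteCast_apply_val]; exact hx i
  · intro hx i; have := congrArg (fun z => (z i : ℕ)) hx; rw [B9Eq319QprimeTorus.blockCoord_apply_val, siteCast_apply_val] at this; exact this

omit [NeZero L] in
/-- **the bonds over `y` stepping inside `y` are the internal bonds of the block of `y` at block size `L^{n+1}`** (through the cast).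
[cite: Balaban1984PropagatorsI, (1.18) p.20; Balaban1985Averaging, (2) p.17] -/
theorem sum_bond_over_eq_cast (h : towerP L m (n + 1) = fineP (L ^ (n + 1)) m) (y : TSite d m) (F : Bond d (towerP L m (n + 1)) → M) :
    ∑ b ∈ Finset.univ.filter (fun b : Bond d (towerP L m (n + 1)) =>
        (∀ i, (b.1 i : ℕ) / L ^ (n + 1) = (y i : ℕ)) ∧ ∀ i, ((shift b.2 b.1) i : ℕ) / L ^ (n + 1) = (y i : ℕ)), F b =
      ∑ b' ∈ Finset.univ.filter (fun b' : Bond d (fineP (L ^ (n + 1)) m) =>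
        blockCoord (L ^ (n + 1)) m b'.1 = y ∧ blockCoord (L ^ (n + 1)) m (shift b'.2 b'.1) = y), F ((siteCast h).symm b'.1, b'.2) := by
  refine Finset.sum_equiv ((siteCast h).prodCongr (Equiv.refl _)) (fun b => ?_) (fun b _ => by simp)
  simp only [Finset.mem_filter, Finset.mem_univ, true_and, Equiv.prodCongr_apply, Prod.map_fst, Prod.map_snd, Equiv.refl_apply]
  have key : ∀ z : TSite d (towerP L m (n + 1)), (∀ i, (z i : ℕ) / L ^ (n + 1) = (y i : ℕ)) ↔ blockCoord (L ^ (n + 1)) m (siteCast h z) = y := by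
    intro z
    constructor
    · intro hz; funext i; apply Fin.ext; rw [B9Eq319QprimeTorus.blockCoord_apply_val, siteCast_apply_val]; exact hz i
    · intro hz i; have := congrArg (fun w => (w i : ℕ)) hz; rw [B9Eq319QprimeTorus.blockCoord_apply_val, siteCast_apply_val] at this; exact this
  rw [key, key, siteCast_shift]

end Transport

section Poincare

variable {W : Type*} [NormedAddCommGroup W] [InnerProductSpace ℂ W] [FiniteDimensional ℂ W]

/-- **BLOCK POINCARÉ WITH MEANS ON THE UNIT BLOCK OF `T_{L^{n+1}m}`**: for every `W`-valued `g` and every unit site `y`,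
`Σ_{x over y}‖g x‖² ≤ 2·((N−1)N∕2)·Σ_{b over y, b₊ over y}‖g(b₊) − g(b₋)‖² + 2N^d·‖N^{−d}Σ_{x over y} g x‖²`, `N = L^{n+1}` — this lineage's (P1)
`sum_block_norm_sq_le_poincare_mean` AT BLOCK SIZE `L^{n+1}` ([B5] (1.18) «L replaced by L^k») transported along `towerP_eq_fineP_pow`.
[cite: Balaban1983RegularityDecay, (2.27) p.580; Balaban1984PropagatorsI, (1.18) p.20; Balaban1985Averaging, (2) p.17] -/
theorem sum_over_norm_sq_le_poincare_mean (y : TSite d m) (g : TSite d (towerP L m (n + 1)) → W) :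
    ∑ x ∈ Finset.univ.filter (fun x : TSite d (towerP L m (n + 1)) => ∀ i, (x i : ℕ) / L ^ (n + 1) = (y i : ℕ)), ‖g x‖ ^ 2 ≤
      2 * ((((L ^ (n + 1) - 1 : ℕ) : ℝ)) * ((L ^ (n + 1) - 1 : ℕ) + 1) / 2) *
          ∑ b ∈ Finset.univ.filter (fun b : Bond d (towerP L m (n + 1)) =>
            (∀ i, (b.1 i : ℕ) / L ^ (n + 1) = (y i : ℕ)) ∧ ∀ i, ((shift b.2 b.1) i : ℕ) / L ^ (n + 1) = (y i : ℕ)), ‖g (shift b.2 b.1) - g b.1‖ ^ 2 +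
        2 * ((L : ℝ) ^ (n + 1)) ^ d *
          ‖(((L : ℝ) ^ (n + 1)) ^ d)⁻¹ • ∑ x ∈ Finset.univ.filter (fun x : TSite d (towerP L m (n + 1)) => ∀ i, (x i : ℕ) / L ^ (n + 1) = (y i : ℕ)), g x‖ ^ 2 := by
  have h : towerP L m (n + 1) = fineP (L ^ (n + 1)) m := towerP_eq_fineP_pow L m (n + 1)
  haveI : NeZero (L ^ (n + 1)) := ⟨pow_ne_zero _ (NeZero.ne L)⟩
  have hn : (L ^ (n + 1) - 1) + 1 = L ^ (n + 1) := Nat.sub_add_cancel (Nat.one_le_pow _ _ (Nat.pos_of_ne_zero (NeZero.ne L)))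
  have key := sum_block_norm_sq_le_poincare_mean (L ^ (n + 1)) m (W := W) hn y (g ∘ (siteCast h).symm)
  rw [sum_over_eq_sum_blockOf_cast L m n h, sum_bond_over_eq_cast L m n h, sum_over_eq_sum_blockOf_cast L m n h]
  have hcast : ((L ^ (n + 1) : ℕ) : ℝ) = (L : ℝ) ^ (n + 1) := by push_cast; rfl
  rw [hcast] at key
  simp only [Function.comp, siteCast_symm, siteCast_shift] at key ⊢
  exact key

omit [InnerProductSpace ℂ W] [FiniteDimensional ℂ W] in
/-- **JENSEN ON THE UNIT BLOCK**: `((N^d)⁻¹ Σ_{x over y}‖l x‖)² ≤ (N^d)⁻¹ Σ_{x over y}‖l x‖²` (`blockMean_norm_sq_le` at block size `L^{n+1}`, transported).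
[cite: Balaban1985Averaging, (2) p.17; Balaban1984PropagatorsI, (1.18) p.20] -/
theorem overMean_norm_sq_le (y : TSite d m) (l : TSite d (towerP L m (n + 1)) → W) :
    ((((L : ℝ) ^ (n + 1)) ^ d)⁻¹ * ∑ x ∈ Finset.univ.filter (fun x : TSite d (towerP L m (n + 1)) => ∀ i, (x i : ℕ) / L ^ (n + 1) = (y i : ℕ)), ‖l x‖) ^ 2 ≤
      (((L : ℝ) ^ (n + 1)) ^ d)⁻¹ * ∑ x ∈ Finset.univ.filter (fun x : TSite d (towerP L m (n + 1)) => ∀ i, (x i : ℕ) / L ^ (n + 1) = (y i : ℕ)), ‖l x‖ ^ 2 := by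
  have h : towerP L m (n + 1) = fineP (L ^ (n + 1)) m := towerP_eq_fineP_pow L m (n + 1)
  haveI : NeZero (L ^ (n + 1)) := ⟨pow_ne_zero _ (NeZero.ne L)⟩
  have key := B9Eq319QprimeLipschitz.blockMean_norm_sq_le (L ^ (n + 1)) m (l ∘ (siteCast h).symm) y
  have hcast : ((L ^ (n + 1) : ℕ) : ℝ) = (L : ℝ) ^ (n + 1) := by push_cast; rfl
  rw [hcast] at key
  rw [sum_over_eq_sum_blockOf_cast L m n h, sum_over_eq_sum_blockOf_cast L m n h]
  exact key

end Poincare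

/-! ## §3 Unit-block bookkeeping of `T_{L^{n+1}m}` -/

section Sums

omit [NeZero L] in
/-- Each site is the endpoint `b₊` of exactly `d` bonds (on the torus `T_{L^{n+1}m}`). [cite: Balaban1985BackgroundPropagators, (3.3) p.390] -/
theorem sum_bond_tgt_eq_tower (F : TSite d (towerP L m (n + 1)) → ℝ) : ∑ b : Bond d (towerP L m (n + 1)), F (shift b.2 b.1) = d * ∑ x, F x := by
  rw [Fintype.sum_prod_type, Finset.sum_comm]
  have h : ∀ μ : Fin d, ∑ x : TSite d (towerP L m (n + 1)), F (shift μ x) = ∑ x, F x := fun μ =>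
    Equiv.sum_comp (shiftEquiv (Pd := towerP L m (n + 1)) μ) F
  simp only [h, Finset.sum_const, Finset.card_univ, Fintype.card_fin, nsmul_eq_mul]

omit [NeZero L] in
/-- the unit-block index of a fine site is a site of `T_m`: `x_i div L^{n+1} < m_i`. [cite: Balaban1985Averaging, (2) p.17] -/
private theorem div_lt_m (x : TSite d (towerP L m (n + 1))) (i : Fin d) : (x i : ℕ) / L ^ (n + 1) < m i :=
  Nat.div_lt_of_lt_mul (lt_of_lt_of_eq (x i).isLt (B9Eq315QTower.towerP_apply L m (n + 1) i))

omit [NeZero L] in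
/-- `Σ_y Σ_{x over y} F x = Σ_x F x` (every fine site lies over exactly one unit site). [cite: Balaban1985Averaging, (2) p.17] -/
theorem sum_over_sum {M : Type*} [AddCommMonoid M] (F : TSite d (towerP L m (n + 1)) → M) :
    ∑ y : TSite d m, ∑ x ∈ Finset.univ.filter (fun x : TSite d (towerP L m (n + 1)) => ∀ i, (x i : ℕ) / L ^ (n + 1) = (y i : ℕ)), F x =
      ∑ x, F x := by
  have h := Finset.sum_fiberwise Finset.univ (fun x : TSite d (towerP L m (n + 1)) => (fun i => (⟨(x i : ℕ) / L ^ (n + 1), div_lt_m L m n x i⟩ : Fin (m i)))) F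
  refine Eq.trans (Finset.sum_congr rfl fun y _ => Finset.sum_congr ?_ fun _ _ => rfl) h
  ext x
  simp only [Finset.mem_filter, Finset.mem_univ, true_and, funext_iff, Fin.ext_iff]

omit [NeZero L] in
/-- internal bonds over the blocks ≤ all bonds (for a nonnegative summand). [cite: Balaban1983RegularityDecay, (2.27) p.580] -/
theorem sum_bond_internal_le (G : Bond d (towerP L m (n + 1)) → ℝ) (hG : ∀ b, 0 ≤ G b) :
    ∑ y : TSite d m, ∑ b ∈ Finset.univ.filter (fun b : Bond d (towerP L m (n + 1)) =>
        (∀ i, (b.1 i : ℕ) / L ^ (n + 1) = (y i : ℕ)) ∧ ∀ i, ((shift b.2 b.1) i : ℕ) / L ^ (n + 1) = (y i : ℕ)), G b ≤ ∑ b, G b := by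
  have h := Finset.sum_fiberwise Finset.univ
    (fun b : Bond d (towerP L m (n + 1)) => (fun i => (⟨(b.1 i : ℕ) / L ^ (n + 1), div_lt_m L m n b.1 i⟩ : Fin (m i)))) G
  rw [← h]
  refine Finset.sum_le_sum fun y _ => Finset.sum_le_sum_of_subset_of_nonneg (fun b hb => ?_) (fun b _ _ => hG b)
  simp only [Finset.mem_filter, Finset.mem_univ, true_and, funext_iff, Fin.ext_iff] at hb ⊢
  exact hb.1

end Sums

end Literature.MathematicalPhysics.QuantumFieldTheory.Balaban1983to89.B9Eq323TowerBlockPoincare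

end
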